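import Mathlib.Analysis.InnerProductSpace.Adjoint
import Mathlib.LinearAlgebra.Matrix.Adjugate
import Mathlib.Topology.Algebra.Module.Determinant
import Literature.Analysis.Calculus.LiouvilleDeterminant
import Literature.Analysis.FluidPDE.IsometryInvariance
import Literature.Analysis.FluidPDE.TaoEnstrophyLocalisation
import HarnessLib

/-!
# Covariance of the curl under linear isometries of `ℝ³`

Topic `Literature/Analysis/FluidPDE` (companion of `IsometryInvariance.lean`, which transports the
velocity-side operators `D`, `(v·∇)v`, `div`, `∇`, `Δ` under `v ↦ R ∘ v ∘ R⁻¹` for a linear isometry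
`R`). The vorticity is a pseudo-vector: for every linear isometry `R` of `ℝ³ = EuclideanSpace ℝ (Fin 3)`
and every field `v : ℝ³ → ℝ³`,

  `curl (R ∘ v ∘ R⁻¹) (x) = (det R) • R (curl v (R⁻¹ x))`,   `det R = ±1`

(the vorticity form of the rotation symmetry `v_Q(x,t) = Qᵗ v(Qx,t)` of the Euler/Navier–Stokes
equations, Majda–Bertozzi 2002 §1.2 Prop. 1.1 (ii): for `R ∈ SO(3)` the vorticity transforms like the
velocity, a reflection flips its sign — the curl is the dual *pseudovector* of the antisymmetric part
of the velocity gradient, Arfken–Weber §2.9 (2.90), (2.97)–(2.99)). The tree had only the special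
cases `curl_rotZ_conj` (rotations about the `x₃`-axis, `PineauVicolEnstrophyTime.lean`) and
`BeltramiSuperposition.curl_conj` (the cyclic permutation of coordinates).

## Main statements (all proved, no new definitions)

* `toMatrixOrthonormal_symm_eq_transpose`, `toMatrixOrthonormal_mul_transpose_eq_one`,
  `toMatrixOrthonormal_transpose_mul_eq_one`: the standard matrix `[R]ᵢₖ = (R eₖ)ᵢ` of a linear
  isometry of `EuclideanSpace ℝ ι` is orthogonal, `[R⁻¹] = [R]ᵀ`, `[R][R]ᵀ = [R]ᵀ[R] = 1`
  (Arfken–Weber §3.3 (3.84), (3.87c)–(3.87d)); `det_linearIsometryEquiv_eq_one_or_eq_neg_one`: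
  `det R = ±1` (Arfken–Weber §3.3 Exercise 3.3.2).
* `curlEntries_conj_of_mul_transpose_eq_one`: `curl[M J Mᵀ] = det M • M curl[J]` for `M Mᵀ = 1`
  (the pseudovector law (2.90) for the dual vector (2.97)–(2.99) of an antisymmetric tensor,
  Arfken–Weber §2.9), from the universal `3 × 3` identity `curl[Gᵀ J G] = adj(G) curl[J]`.
* `curlCLM_conj_linearIsometryEquiv`: `curlCLM (R ∘ A ∘ R⁻¹) = det R • R (curlCLM A)` for every
  Jacobian `A : ℝ³ →L[ℝ] ℝ³`.
* `curl_conj_linearIsometryEquiv`: the displayed identity (no differentiability hypothesis: both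
  sides carry the junk value `0` at points where `v` is not differentiable);
  `inner_curl_conj_linearIsometryEquiv`, `norm_curl_conj_linearIsometryEquiv`,
  `inner_curl_conj_linearIsometryEquiv_eq_zero_iff`.

## References

* G. B. Arfken, H.-J. Weber, *Mathematical Methods for Physicists*, 4th ed. (Academic Press 1995),
  §2.9 "Pseudotensors, dual tensors", eq. (2.90) (`C'ᵢ = |a| aᵢⱼ Cⱼ`), (2.97)–(2.99) (dual
  pseudovector of an antisymmetric tensor); §3.3 "Orthogonal matrices", (3.84), (3.87a)–(3.87d),
  Exercise 3.3.2 (`det = ±1`). [ArfkenWeber1995]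
* A. J. Majda, A. L. Bertozzi, *Vorticity and Incompressible Flow* (CUP 2002), §1.2 Prop. 1.1 (ii)
  (rotation symmetry `v_Q(x,t) = Qᵗ v(Qx,t)`, eq. (1.10)). [MajdaBertozziCUP2002]
-/

noncomputable section

open Matrix
open scoped InnerProductSpace RealInnerProductSpace Matrix

namespace Literature.Analysis.FluidPDE

/-! ### The standard matrix of a linear isometry of `EuclideanSpace ℝ ι` is orthogonal -/

section Orthogonal

variable {ι : Type*} [Fintype ι] [DecidableEq ι]

/-- **The inverse of an orthogonal matrix is its transpose**, for the standard matrix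
`[R]ᵢₖ = (R eₖ)ᵢ` of a linear isometry `R` of `EuclideanSpace ℝ ι`: `[R⁻¹] = [R]ᵀ`
(Arfken–Weber, orthogonality condition `Ã = A⁻¹`). [cite: ArfkenWeber1995, §3.3 eq. (3.84) = (3.87d)] -/
theorem toMatrixOrthonormal_symm_eq_transpose (R : EuclideanSpace ℝ ι ≃ₗᵢ[ℝ] EuclideanSpace ℝ ι) :
    LinearMap.toMatrixOrthonormal (EuclideanSpace.basisFun ι ℝ)
        ((R.symm : EuclideanSpace ℝ ι →L[ℝ] EuclideanSpace ℝ ι) :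
          EuclideanSpace ℝ ι →ₗ[ℝ] EuclideanSpace ℝ ι) =
      (LinearMap.toMatrixOrthonormal (EuclideanSpace.basisFun ι ℝ)
        ((R : EuclideanSpace ℝ ι →L[ℝ] EuclideanSpace ℝ ι) :
          EuclideanSpace ℝ ι →ₗ[ℝ] EuclideanSpace ℝ ι))ᵀ := by
  ext i k
  rw [Matrix.transpose_apply, Literature.Analysis.Calculus.toMatrixOrthonormal_basisFun_apply,
    Literature.Analysis.Calculus.toMatrixOrthonormal_basisFun_apply]
  have h1 : (R.symm : EuclideanSpace ℝ ι →L[ℝ] EuclideanSpace ℝ ι) (EuclideanSpace.single k (1 : ℝ)) i =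
      ⟪R.symm (EuclideanSpace.single k (1 : ℝ)), EuclideanSpace.single i (1 : ℝ)⟫ := by
    rw [EuclideanSpace.inner_single_right]
    simp
  have h2 : (R : EuclideanSpace ℝ ι →L[ℝ] EuclideanSpace ℝ ι) (EuclideanSpace.single i (1 : ℝ)) k =
      ⟪EuclideanSpace.single k (1 : ℝ), R (EuclideanSpace.single i (1 : ℝ))⟫ := by
    rw [EuclideanSpace.inner_single_left]
    simp
  rw [h1, h2, LinearIsometryEquiv.inner_map_eq_flip, LinearIsometryEquiv.symm_symm]

/-- **Orthogonality condition `A Ã = 1`** for the standard matrix of a linear isometry `R` of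
`EuclideanSpace ℝ ι`: `[R] [R]ᵀ = 1`. [cite: ArfkenWeber1995, §3.3 eq. (3.87c)] -/
theorem toMatrixOrthonormal_mul_transpose_eq_one (R : EuclideanSpace ℝ ι ≃ₗᵢ[ℝ] EuclideanSpace ℝ ι) :
    LinearMap.toMatrixOrthonormal (EuclideanSpace.basisFun ι ℝ)
        ((R : EuclideanSpace ℝ ι →L[ℝ] EuclideanSpace ℝ ι) :
          EuclideanSpace ℝ ι →ₗ[ℝ] EuclideanSpace ℝ ι) *
      (LinearMap.toMatrixOrthonormal (EuclideanSpace.basisFun ι ℝ)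
        ((R : EuclideanSpace ℝ ι →L[ℝ] EuclideanSpace ℝ ι) :
          EuclideanSpace ℝ ι →ₗ[ℝ] EuclideanSpace ℝ ι))ᵀ = 1 := by
  rw [← toMatrixOrthonormal_symm_eq_transpose, ← map_mul]
  have h : ((R : EuclideanSpace ℝ ι →L[ℝ] EuclideanSpace ℝ ι) :
        EuclideanSpace ℝ ι →ₗ[ℝ] EuclideanSpace ℝ ι) *
      ((R.symm : EuclideanSpace ℝ ι →L[ℝ] EuclideanSpace ℝ ι) :
        EuclideanSpace ℝ ι →ₗ[ℝ] EuclideanSpace ℝ ι) = 1 := by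
    ext x
    simp
  rw [h, map_one]

/-- **Orthogonality condition `Ã A = 1`** for the standard matrix of a linear isometry `R` of
`EuclideanSpace ℝ ι`: `[R]ᵀ [R] = 1`. [cite: ArfkenWeber1995, §3.3 eq. (3.87c)] -/
theorem toMatrixOrthonormal_transpose_mul_eq_one (R : EuclideanSpace ℝ ι ≃ₗᵢ[ℝ] EuclideanSpace ℝ ι) :
    (LinearMap.toMatrixOrthonormal (EuclideanSpace.basisFun ι ℝ)
        ((R : EuclideanSpace ℝ ι →L[ℝ] EuclideanSpace ℝ ι) :
          EuclideanSpace ℝ ι →ₗ[ℝ] EuclideanSpace ℝ ι))ᵀ *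
      LinearMap.toMatrixOrthonormal (EuclideanSpace.basisFun ι ℝ)
        ((R : EuclideanSpace ℝ ι →L[ℝ] EuclideanSpace ℝ ι) :
          EuclideanSpace ℝ ι →ₗ[ℝ] EuclideanSpace ℝ ι) = 1 := by
  rw [← toMatrixOrthonormal_symm_eq_transpose, ← map_mul]
  have h : ((R.symm : EuclideanSpace ℝ ι →L[ℝ] EuclideanSpace ℝ ι) :
        EuclideanSpace ℝ ι →ₗ[ℝ] EuclideanSpace ℝ ι) *
      ((R : EuclideanSpace ℝ ι →L[ℝ] EuclideanSpace ℝ ι) :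
        EuclideanSpace ℝ ι →ₗ[ℝ] EuclideanSpace ℝ ι) = 1 := by
    ext x
    simp
  rw [h, map_one]

/-- The determinant of the standard matrix is the determinant of the operator (plumbing). [folklore] -/
private theorem det_toMatrixOrthonormal_basisFun (L : EuclideanSpace ℝ ι →L[ℝ] EuclideanSpace ℝ ι) :
    (LinearMap.toMatrixOrthonormal (EuclideanSpace.basisFun ι ℝ)
        (L : EuclideanSpace ℝ ι →ₗ[ℝ] EuclideanSpace ℝ ι)).det = L.det := by
  rw [Literature.Analysis.Calculus.toMatrixOrthonormal_basisFun_eq_toMatrix, LinearMap.det_toMatrix]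

/-- **`det R = ±1`** for a linear isometry `R` of `EuclideanSpace ℝ ι` (`det [R] · det [R]ᵀ = det 1`;
Arfken–Weber: "if `A` is orthogonal, its determinant `= ±1`"). [cite: ArfkenWeber1995, §3.3 Exercise 3.3.2] -/
theorem det_linearIsometryEquiv_eq_one_or_eq_neg_one
    (R : EuclideanSpace ℝ ι ≃ₗᵢ[ℝ] EuclideanSpace ℝ ι) :
    (R : EuclideanSpace ℝ ι →L[ℝ] EuclideanSpace ℝ ι).det = 1 ∨
      (R : EuclideanSpace ℝ ι →L[ℝ] EuclideanSpace ℝ ι).det = -1 := by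
  have h := congrArg Matrix.det (toMatrixOrthonormal_mul_transpose_eq_one R)
  rw [Matrix.det_mul, Matrix.det_transpose, Matrix.det_one, det_toMatrixOrthonormal_basisFun] at h
  exact mul_self_eq_one_iff.1 h

/-- `(det R)² = 1` for a linear isometry `R` of `EuclideanSpace ℝ ι`. [cite: ArfkenWeber1995, §3.3 Exercise 3.3.2] -/
theorem det_linearIsometryEquiv_mul_self
    (R : EuclideanSpace ℝ ι ≃ₗᵢ[ℝ] EuclideanSpace ℝ ι) :
    (R : EuclideanSpace ℝ ι →L[ℝ] EuclideanSpace ℝ ι).det *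
      (R : EuclideanSpace ℝ ι →L[ℝ] EuclideanSpace ℝ ι).det = 1 := by
  rcases det_linearIsometryEquiv_eq_one_or_eq_neg_one R with h | h <;> rw [h] <;> norm_num

end Orthogonal

/-! ### The `3 × 3` algebra: `curl[Gᵀ J G] = adj(G) curl[J]` -/

section MatrixAlgebra

/-- **The pull-back identity for Jacobian matrices** (universal over `3 × 3` real matrices): with
`curl[J] = (J₂₁ − J₁₂, J₀₂ − J₂₀, J₁₀ − J₀₁)` (`Jᵢₖ = ∂ₖvᵢ`), `curl[Gᵀ J G] = adj(G) curl[J]`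
(the cross product of two columns of `G` is a column of its cofactor matrix; helper). [folklore] -/
private theorem curlEntries_conj_transpose (G J : Matrix (Fin 3) (Fin 3) ℝ) :
    ![(Gᵀ * J * G) 2 1 - (Gᵀ * J * G) 1 2, (Gᵀ * J * G) 0 2 - (Gᵀ * J * G) 2 0,
        (Gᵀ * J * G) 1 0 - (Gᵀ * J * G) 0 1] =
      G.adjugate *ᵥ ![J 2 1 - J 1 2, J 0 2 - J 2 0, J 1 0 - J 0 1] := by
  funext i
  fin_cases i <;>
    simp [Matrix.mul_apply, Fin.sum_univ_three, Matrix.transpose_apply, Matrix.adjugate_fin_three,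
      Matrix.mulVec, dotProduct] <;> ring

/-- For an orthogonal `M` (`M Mᵀ = 1`): `adj(M) = det M • Mᵀ` (Cramer; helper). [folklore] -/
private theorem adjugate_eq_det_smul_transpose_of_mul_transpose_eq_one {M : Matrix (Fin 3) (Fin 3) ℝ}
    (hM : M * Mᵀ = 1) : M.adjugate = M.det • Mᵀ := by
  calc M.adjugate = M.adjugate * (M * Mᵀ) := by rw [hM, Matrix.mul_one]
    _ = M.adjugate * M * Mᵀ := (Matrix.mul_assoc _ _ _).symm
    _ = M.det • Mᵀ := by rw [Matrix.adjugate_mul, Matrix.smul_mul, Matrix.one_mul]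

/-- **The curl is a pseudovector** (matrix form): with `curl[J] = (J₂₁ − J₁₂, J₀₂ − J₂₀, J₁₀ − J₀₁)`
the dual vector of the antisymmetric part of a Jacobian matrix `J` (`Jᵢₖ = ∂ₖvᵢ`), for every orthogonal
`3 × 3` matrix `M` (`M Mᵀ = 1`): `curl[M J Mᵀ] = det M • M curl[J]` — Arfken–Weber's transformation law
`C'ᵢ = |a| aᵢⱼ Cⱼ` (2.90) of the dual pseudovector (2.97)–(2.99) of an antisymmetric second-rank tensor.
[cite: ArfkenWeber1995, §2.9 eq. (2.90), (2.97)–(2.99)] -/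
theorem curlEntries_conj_of_mul_transpose_eq_one {M : Matrix (Fin 3) (Fin 3) ℝ} (hM : M * Mᵀ = 1)
    (J : Matrix (Fin 3) (Fin 3) ℝ) :
    ![(M * J * Mᵀ) 2 1 - (M * J * Mᵀ) 1 2, (M * J * Mᵀ) 0 2 - (M * J * Mᵀ) 2 0,
        (M * J * Mᵀ) 1 0 - (M * J * Mᵀ) 0 1] =
      M.det • (M *ᵥ ![J 2 1 - J 1 2, J 0 2 - J 2 0, J 1 0 - J 0 1]) := by
  have h := curlEntries_conj_transpose Mᵀ J
  rw [Matrix.transpose_transpose] at h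
  rw [h, ← Matrix.adjugate_transpose, adjugate_eq_det_smul_transpose_of_mul_transpose_eq_one hM,
    Matrix.transpose_smul, Matrix.transpose_transpose, Matrix.smul_mulVec]

end MatrixAlgebra

/-! ### Covariance of `curlCLM` and `curl` -/

section Curl

/-- Coordinates of `curlCLM A` in terms of the standard matrix `[A]ᵢₖ = (A eₖ)ᵢ` of the Jacobian:
`curlCLM A = ([A]₂₁ − [A]₁₂, [A]₀₂ − [A]₂₀, [A]₁₀ − [A]₀₁)` (helper, definitional). [folklore] -/
private theorem curlCLM_apply_eq_toMatrixOrthonormal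
    (A : EuclideanSpace ℝ (Fin 3) →L[ℝ] EuclideanSpace ℝ (Fin 3)) (i : Fin 3) :
    curlCLM A i =
      ![LinearMap.toMatrixOrthonormal (EuclideanSpace.basisFun (Fin 3) ℝ)
            (A : EuclideanSpace ℝ (Fin 3) →ₗ[ℝ] EuclideanSpace ℝ (Fin 3)) 2 1 -
          LinearMap.toMatrixOrthonormal (EuclideanSpace.basisFun (Fin 3) ℝ)
            (A : EuclideanSpace ℝ (Fin 3) →ₗ[ℝ] EuclideanSpace ℝ (Fin 3)) 1 2,
        LinearMap.toMatrixOrthonormal (EuclideanSpace.basisFun (Fin 3) ℝ)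
            (A : EuclideanSpace ℝ (Fin 3) →ₗ[ℝ] EuclideanSpace ℝ (Fin 3)) 0 2 -
          LinearMap.toMatrixOrthonormal (EuclideanSpace.basisFun (Fin 3) ℝ)
            (A : EuclideanSpace ℝ (Fin 3) →ₗ[ℝ] EuclideanSpace ℝ (Fin 3)) 2 0,
        LinearMap.toMatrixOrthonormal (EuclideanSpace.basisFun (Fin 3) ℝ)
            (A : EuclideanSpace ℝ (Fin 3) →ₗ[ℝ] EuclideanSpace ℝ (Fin 3)) 1 0 -
          LinearMap.toMatrixOrthonormal (EuclideanSpace.basisFun (Fin 3) ℝ)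
            (A : EuclideanSpace ℝ (Fin 3) →ₗ[ℝ] EuclideanSpace ℝ (Fin 3)) 0 1] i := by
  simp only [Literature.Analysis.Calculus.toMatrixOrthonormal_basisFun_apply]
  fin_cases i <;> rfl

/-- **Covariance of the curl of a Jacobian**: for a linear isometry `R` of `ℝ³` and every
`A : ℝ³ →L[ℝ] ℝ³`, `curlCLM (R ∘ A ∘ R⁻¹) = det R • R (curlCLM A)` — the pseudovector law
`C'ᵢ = |a| aᵢⱼ Cⱼ` for the dual vector of the antisymmetric part of the conjugated Jacobian `R A R⁻¹`
(`[R A R⁻¹] = [R][A][R]ᵀ` by (3.87d)). [cite: ArfkenWeber1995, §2.9 eq. (2.90), (2.97)–(2.99)] -/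
theorem curlCLM_conj_linearIsometryEquiv
    (R : EuclideanSpace ℝ (Fin 3) ≃ₗᵢ[ℝ] EuclideanSpace ℝ (Fin 3))
    (A : EuclideanSpace ℝ (Fin 3) →L[ℝ] EuclideanSpace ℝ (Fin 3)) :
    curlCLM ((R : EuclideanSpace ℝ (Fin 3) →L[ℝ] EuclideanSpace ℝ (Fin 3)).comp
        (A.comp (R.symm : EuclideanSpace ℝ (Fin 3) →L[ℝ] EuclideanSpace ℝ (Fin 3)))) =
      (R : EuclideanSpace ℝ (Fin 3) →L[ℝ] EuclideanSpace ℝ (Fin 3)).det • R (curlCLM A) := by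
  set b := EuclideanSpace.basisFun (Fin 3) ℝ with hb
  set M := LinearMap.toMatrixOrthonormal b
    ((R : EuclideanSpace ℝ (Fin 3) →L[ℝ] EuclideanSpace ℝ (Fin 3)) :
      EuclideanSpace ℝ (Fin 3) →ₗ[ℝ] EuclideanSpace ℝ (Fin 3)) with hM
  set N := LinearMap.toMatrixOrthonormal b
    (A : EuclideanSpace ℝ (Fin 3) →ₗ[ℝ] EuclideanSpace ℝ (Fin 3)) with hN
  have hMt : LinearMap.toMatrixOrthonormal b
      ((R.symm : EuclideanSpace ℝ (Fin 3) →L[ℝ] EuclideanSpace ℝ (Fin 3)) :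
        EuclideanSpace ℝ (Fin 3) →ₗ[ℝ] EuclideanSpace ℝ (Fin 3)) = Mᵀ :=
    toMatrixOrthonormal_symm_eq_transpose R
  have hMM : M * Mᵀ = 1 := toMatrixOrthonormal_mul_transpose_eq_one R
  -- the standard matrix of the conjugated Jacobian
  have hconj : LinearMap.toMatrixOrthonormal b
      (((R : EuclideanSpace ℝ (Fin 3) →L[ℝ] EuclideanSpace ℝ (Fin 3)).comp
          (A.comp (R.symm : EuclideanSpace ℝ (Fin 3) →L[ℝ] EuclideanSpace ℝ (Fin 3)))) :
        EuclideanSpace ℝ (Fin 3) →ₗ[ℝ] EuclideanSpace ℝ (Fin 3)) = M * N * Mᵀ := by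
    rw [← hMt, hM, hN, ← map_mul, ← map_mul]
    exact congrArg _ (LinearMap.ext fun x => rfl)
  have key := curlEntries_conj_of_mul_transpose_eq_one hMM N
  -- coordinates of `curlCLM A`
  have hc : (fun k => curlCLM A k) = ![N 2 1 - N 1 2, N 0 2 - N 2 0, N 1 0 - N 0 1] := by
    funext k
    rw [curlCLM_apply_eq_toMatrixOrthonormal]
  have hdet : (R : EuclideanSpace ℝ (Fin 3) →L[ℝ] EuclideanSpace ℝ (Fin 3)).det = M.det :=
    (det_toMatrixOrthonormal_basisFun _).symm
  ext i
  rw [curlCLM_apply_eq_toMatrixOrthonormal, hconj, key, PiLp.smul_apply, smul_eq_mul, hdet]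
  have hR : R (curlCLM A) i = (M *ᵥ fun k => curlCLM A k) i := by
    rw [hM]
    exact Literature.Analysis.Calculus.apply_apply_eq_toMatrixOrthonormal_mulVec
      (R : EuclideanSpace ℝ (Fin 3) →L[ℝ] EuclideanSpace ℝ (Fin 3)) (curlCLM A) i
  rw [hR, hc, Pi.smul_apply, smul_eq_mul]

/-- **Covariance of the curl under linear isometries** (the vorticity is a pseudo-vector): for a
linear isometry `R` of `ℝ³`, a field `v : ℝ³ → ℝ³` and every `x`,
`curl (R ∘ v ∘ R⁻¹) (x) = det R • R (curl v (R⁻¹ x))`. No differentiability hypothesis is needed: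
if `v` is not differentiable at `R⁻¹ x` both sides are the junk value `0`. This is the vorticity
form of the rotation symmetry `v_Q(x) = Qᵗ v(Qx)` of the Euler/Navier–Stokes equations
(Majda–Bertozzi 2002, §1.2 Prop. 1.1 (ii), eq. (1.10), with `R = Qᵗ`): `ω_Q(x) = (det Q) Qᵗ ω(Qx)`,
the curl being the dual pseudovector (2.97)–(2.99) of the antisymmetric velocity-gradient tensor,
which transforms by (2.90). [cite: ArfkenWeber1995, §2.9 eq. (2.90), (2.97)–(2.99)] -/
theorem curl_conj_linearIsometryEquiv
    (R : EuclideanSpace ℝ (Fin 3) ≃ₗᵢ[ℝ] EuclideanSpace ℝ (Fin 3))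
    (v : EuclideanSpace ℝ (Fin 3) → EuclideanSpace ℝ (Fin 3)) (x : EuclideanSpace ℝ (Fin 3)) :
    curl (fun y => R (v (R.symm y))) x =
      (R : EuclideanSpace ℝ (Fin 3) →L[ℝ] EuclideanSpace ℝ (Fin 3)).det • R (curl v (R.symm x)) := by
  rw [curl_eq_curlCLM, fderiv_conj_linearIsometryEquiv, curlCLM_conj_linearIsometryEquiv,
    ← curl_eq_curlCLM]

/-- The curl of the conjugated field against a rotated direction:
`⟪curl (R ∘ v ∘ R⁻¹)(x), R e⟫ = det R · ⟪curl v (R⁻¹ x), e⟫` (component form of the pseudovector law).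
[cite: ArfkenWeber1995, §2.9 eq. (2.90), (2.97)–(2.99)] -/
theorem inner_curl_conj_linearIsometryEquiv
    (R : EuclideanSpace ℝ (Fin 3) ≃ₗᵢ[ℝ] EuclideanSpace ℝ (Fin 3))
    (v : EuclideanSpace ℝ (Fin 3) → EuclideanSpace ℝ (Fin 3)) (x e : EuclideanSpace ℝ (Fin 3)) :
    ⟪curl (fun y => R (v (R.symm y))) x, R e⟫ =
      (R : EuclideanSpace ℝ (Fin 3) →L[ℝ] EuclideanSpace ℝ (Fin 3)).det * ⟪curl v (R.symm x), e⟫ := by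
  rw [curl_conj_linearIsometryEquiv, inner_smul_left, LinearIsometryEquiv.inner_map_map]
  simp

/-- The e-component of the curl of the conjugated field vanishes iff the `R⁻¹e`-component of the
original curl vanishes at the pre-image point (`det R = ±1`). [cite: ArfkenWeber1995, §2.9 eq. (2.90), (2.97)–(2.99)] -/
theorem inner_curl_conj_linearIsometryEquiv_eq_zero_iff
    (R : EuclideanSpace ℝ (Fin 3) ≃ₗᵢ[ℝ] EuclideanSpace ℝ (Fin 3))
    (v : EuclideanSpace ℝ (Fin 3) → EuclideanSpace ℝ (Fin 3)) (x e : EuclideanSpace ℝ (Fin 3)) :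
    ⟪curl (fun y => R (v (R.symm y))) x, e⟫ = 0 ↔ ⟪curl v (R.symm x), R.symm e⟫ = 0 := by
  have h := inner_curl_conj_linearIsometryEquiv R v x (R.symm e)
  rw [LinearIsometryEquiv.apply_symm_apply] at h
  rw [h, mul_eq_zero, or_iff_right]
  rcases det_linearIsometryEquiv_eq_one_or_eq_neg_one R with h1 | h1 <;> rw [h1] <;> norm_num

/-- The vorticity magnitude is invariant: `‖curl (R ∘ v ∘ R⁻¹)(x)‖ = ‖curl v (R⁻¹ x)‖` (a pseudovector
changes at most its sign, `|a| = ±1`). [cite: ArfkenWeber1995, §2.9 eq. (2.90), (2.97)–(2.99)] -/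
theorem norm_curl_conj_linearIsometryEquiv
    (R : EuclideanSpace ℝ (Fin 3) ≃ₗᵢ[ℝ] EuclideanSpace ℝ (Fin 3))
    (v : EuclideanSpace ℝ (Fin 3) → EuclideanSpace ℝ (Fin 3)) (x : EuclideanSpace ℝ (Fin 3)) :
    ‖curl (fun y => R (v (R.symm y))) x‖ = ‖curl v (R.symm x)‖ := by
  rw [curl_conj_linearIsometryEquiv, norm_smul, LinearIsometryEquiv.norm_map]
  rcases det_linearIsometryEquiv_eq_one_or_eq_neg_one R with h | h <;> rw [h] <;> simp

end Curl

end Literature.Analysis.FluidPDE
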